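import Mathlib
import HarnessLib
import Literature.Computability.AlgebraicComplexity.HessianRank

/-!
# Crux `RankDefectRepresentations` (stmt-PneNP-18923), line `rank-dehn-ladder`: the SORTING LEMMA (`stub_sortingLemma`)

Negative rung N0a of the skeleton `Cruxes/RankDefectRepresentations/Lines/rank_dehn_ladder.lean` (lead g5 reshape):
exact involutions `U_0, …, U_{n-1}` (`U_i² = 1`) whose pairwise commutators have rank `≤ t` generate, through their
SORTED PRODUCTS `ρ(S) = ∏_{i ∈ S, i increasing} U_i` (`S ⊆ [n]`), a UNIFORM almost-homomorphism of the elementary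
abelian group `Z_2^n = (2^{[n]}, △)` in the rank metric:

  `rank (ρ(S) · ρ(T) − ρ(S △ T)) ≤ |S| · |T| · t`   for all `S, T`.

Proof (bubble sort): peel the letters of the word for `T` from the left; moving a letter `U_a` leftward through the
sorted word for `S` costs one commutator `[U_i, U_a]` per letter passed (Leibniz rule, `rank_comm_lprod_le`), and the
cancellation `U_a U_a = 1` is exact; so each letter of `T` costs `≤ |S| · t`.

Consequence (proved in the skeleton, not here): the multiplication-table ("Ulam") rank-stability of `Z_2^n` with a
constant polynomial in `n` would give polynomial rank-stability of the Boolean/commutator presentation and hence REFUTE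
the crux (`not_rankDefectRepresentations_of_polyStable`, p542939). In the Hilbert–Schmidt and Hamming metrics the
multiplication-table presentation of every finite group is stable with an absolute constant (Gowers–Hatami; Becker–Chapman),
which is why this reformulation isolates exactly what is special about rank. HONEST FRAMING: an elementary counting lemma;
P ≠ NP is not moved; F-N2 is a FRONTIER formal rung.
-/

set_option linter.dupNamespace false -- `Summit.PneNP.PneNP.…`: summit = sub-problem name (D-0017)

namespace Summit.PneNP.PneNP.Theorems.CnfIdealGenLengthRankDefectRepresentationsSortingLemma

open Literature.Computability.AlgebraicComplexity (rank_add_le)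

variable {K : Type} [Field K] {n d : ℕ}

omit [Field K] in
/-- Unfolding the ordered product on a cons whose head lies in `S`. -/
theorem lprod_cons_of_mem [Field K] (U : Fin n → Matrix (Fin d) (Fin d) K) {a : Fin n} {l : List (Fin n)}
    {S : Finset (Fin n)} (ha : a ∈ S) : (((a :: l).filter (· ∈ S)).map U).prod = U a * (((l).filter (· ∈ S)).map U).prod := by
  rw [List.filter_cons_of_pos (by simpa using ha), List.map_cons, List.prod_cons]

omit [Field K] in
/-- Unfolding the ordered product on a cons whose head lies outside `S`. -/
theorem lprod_cons_of_not_mem [Field K] (U : Fin n → Matrix (Fin d) (Fin d) K) {a : Fin n} {l : List (Fin n)}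
    {S : Finset (Fin n)} (ha : a ∉ S) : (((a :: l).filter (· ∈ S)).map U).prod = (((l).filter (· ∈ S)).map U).prod := by
  rw [List.filter_cons_of_neg (by simpa using ha)]

/-- Leibniz bookkeeping: the commutator of an ordered product with `A` has rank at most the number of factors times
the maximal rank of a letter commutator `[U_i, A]`. [folklore] -/
theorem rank_comm_lprod_le (U : Fin n → Matrix (Fin d) (Fin d) K) (A : Matrix (Fin d) (Fin d) K) {t : ℕ}
    (hc : ∀ i, (U i * A - A * U i).rank ≤ t) (S : Finset (Fin n)) :
    ∀ l : List (Fin n), ((((l).filter (· ∈ S)).map U).prod * A - A * (((l).filter (· ∈ S)).map U).prod).rank ≤ (l.filter (· ∈ S)).length * t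
  | [] => by simp
  | a :: l => by
      by_cases ha : a ∈ S
      · rw [lprod_cons_of_mem U ha, List.filter_cons_of_pos (by simpa using ha), List.length_cons]
        have hsplit : U a * (((l).filter (· ∈ S)).map U).prod * A - A * (U a * (((l).filter (· ∈ S)).map U).prod)
            = U a * ((((l).filter (· ∈ S)).map U).prod * A - A * (((l).filter (· ∈ S)).map U).prod) + (U a * A - A * U a) * (((l).filter (· ∈ S)).map U).prod := by
          noncomm_ring
        rw [hsplit]
        refine (rank_add_le _ _).trans ?_
        have h1 := (Matrix.rank_mul_le_right (U a) ((((l).filter (· ∈ S)).map U).prod * A - A * (((l).filter (· ∈ S)).map U).prod)).trans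
          (rank_comm_lprod_le U A hc S l)
        have h2 := (Matrix.rank_mul_le_left (U a * A - A * U a) ((((l).filter (· ∈ S)).map U).prod)).trans (hc a)
        have : (l.filter (· ∈ S)).length * t + t = ((l.filter (· ∈ S)).length + 1) * t := by ring
        rw [← this]
        exact Nat.add_le_add h1 h2
      · rw [lprod_cons_of_not_mem U ha, List.filter_cons_of_neg (by simpa using ha)]
        exact rank_comm_lprod_le U A hc S l

omit [Field K] in
/-- For a duplicate-free list, the number of its letters in `S` is at most `|S|`. -/
theorem length_filter_mem_le_card {l : List (Fin n)} (hl : l.Nodup) (S : Finset (Fin n)) :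
    (l.filter (· ∈ S)).length ≤ S.card := by
  classical
  have hnd : (l.filter (· ∈ S)).Nodup := hl.filter _
  rw [← List.toFinset_card_of_nodup hnd]
  refine Finset.card_le_card fun x hx => ?_
  rw [List.mem_toFinset, List.mem_filter] at hx
  simpa using hx.2

/-- **The sorting lemma along a duplicate-free list.** For exact involutions with letter commutators of rank `≤ t`,
`rank (P_l(S) P_l(T) − P_l(S △ T)) ≤ |S| · #{a ∈ l : a ∈ T} · t`. [folklore] -/
theorem rank_lprod_mul_sub_le (U : Fin n → Matrix (Fin d) (Fin d) K) {t : ℕ} (hU : ∀ i, U i * U i = 1)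
    (ht : ∀ i j, (U i * U j - U j * U i).rank ≤ t) (S T : Finset (Fin n)) :
    ∀ l : List (Fin n), l.Nodup →
      ((((l).filter (· ∈ S)).map U).prod * (((l).filter (· ∈ T)).map U).prod - (((l).filter (· ∈ (symmDiff S T))).map U).prod).rank ≤ S.card * (l.filter (· ∈ T)).length * t
  | [], _ => by simp
  | a :: l, hnd => by
      have hl : l.Nodup := (List.nodup_cons.mp hnd).2
      have IH := rank_lprod_mul_sub_le U hU ht S T l hl
      have hcomm : ((((l).filter (· ∈ S)).map U).prod * U a - U a * (((l).filter (· ∈ S)).map U).prod).rank ≤ S.card * t :=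
        (rank_comm_lprod_le U (U a) (fun i => ht i a) S l).trans
          (Nat.mul_le_mul_right t (length_filter_mem_le_card hl S))
      by_cases haS : a ∈ S <;> by_cases haT : a ∈ T
      · -- a ∈ S, a ∈ T : a ∉ S △ T, the two copies of `U a` cancel after one pass through the S-word
        have hst : a ∉ symmDiff S T := by simp [Finset.mem_symmDiff, haS, haT]
        rw [lprod_cons_of_mem U haS, lprod_cons_of_mem U haT, lprod_cons_of_not_mem U hst,
          List.filter_cons_of_pos (by simpa using haT), List.length_cons]
        have hsplit : U a * (((l).filter (· ∈ S)).map U).prod * (U a * (((l).filter (· ∈ T)).map U).prod) - (((l).filter (· ∈ (symmDiff S T))).map U).prod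
            = U a * ((((l).filter (· ∈ S)).map U).prod * U a - U a * (((l).filter (· ∈ S)).map U).prod) * (((l).filter (· ∈ T)).map U).prod
              + ((U a * U a) * (((l).filter (· ∈ S)).map U).prod * (((l).filter (· ∈ T)).map U).prod - (((l).filter (· ∈ (symmDiff S T))).map U).prod) := by
          noncomm_ring
        rw [hsplit, hU a, one_mul]
        refine (rank_add_le _ _).trans ?_
        have h1 : (U a * ((((l).filter (· ∈ S)).map U).prod * U a - U a * (((l).filter (· ∈ S)).map U).prod) * (((l).filter (· ∈ T)).map U).prod).rank ≤ S.card * t :=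
          ((Matrix.rank_mul_le_left _ _).trans (Matrix.rank_mul_le_right _ _)).trans hcomm
        have : S.card * ((l.filter (· ∈ T)).length + 1) * t
            = S.card * t + S.card * (l.filter (· ∈ T)).length * t := by ring
        rw [this]
        exact Nat.add_le_add h1 IH
      · -- a ∈ S, a ∉ T : a ∈ S △ T, `U a` factors out on the left
        have hst : a ∈ symmDiff S T := by simp [Finset.mem_symmDiff, haS, haT]
        rw [lprod_cons_of_mem U haS, lprod_cons_of_not_mem U haT, lprod_cons_of_mem U hst,
          List.filter_cons_of_neg (by simpa using haT)]
        have hsplit : U a * (((l).filter (· ∈ S)).map U).prod * (((l).filter (· ∈ T)).map U).prod - U a * (((l).filter (· ∈ (symmDiff S T))).map U).prod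
            = U a * ((((l).filter (· ∈ S)).map U).prod * (((l).filter (· ∈ T)).map U).prod - (((l).filter (· ∈ (symmDiff S T))).map U).prod) := by noncomm_ring
        rw [hsplit]
        exact (Matrix.rank_mul_le_right _ _).trans IH
      · -- a ∉ S, a ∈ T : a ∈ S △ T, `U a` passes through the S-word once
        have hst : a ∈ symmDiff S T := by simp [Finset.mem_symmDiff, haS, haT]
        rw [lprod_cons_of_not_mem U haS, lprod_cons_of_mem U haT, lprod_cons_of_mem U hst,
          List.filter_cons_of_pos (by simpa using haT), List.length_cons]
        have hsplit : (((l).filter (· ∈ S)).map U).prod * (U a * (((l).filter (· ∈ T)).map U).prod) - U a * (((l).filter (· ∈ (symmDiff S T))).map U).prod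
            = ((((l).filter (· ∈ S)).map U).prod * U a - U a * (((l).filter (· ∈ S)).map U).prod) * (((l).filter (· ∈ T)).map U).prod
              + U a * ((((l).filter (· ∈ S)).map U).prod * (((l).filter (· ∈ T)).map U).prod - (((l).filter (· ∈ (symmDiff S T))).map U).prod) := by
          noncomm_ring
        rw [hsplit]
        refine (rank_add_le _ _).trans ?_
        have h1 : (((((l).filter (· ∈ S)).map U).prod * U a - U a * (((l).filter (· ∈ S)).map U).prod) * (((l).filter (· ∈ T)).map U).prod).rank ≤ S.card * t :=
          (Matrix.rank_mul_le_left _ _).trans hcomm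
        have h2 : (U a * ((((l).filter (· ∈ S)).map U).prod * (((l).filter (· ∈ T)).map U).prod - (((l).filter (· ∈ (symmDiff S T))).map U).prod)).rank
            ≤ S.card * (l.filter (· ∈ T)).length * t := (Matrix.rank_mul_le_right _ _).trans IH
        have : S.card * ((l.filter (· ∈ T)).length + 1) * t
            = S.card * t + S.card * (l.filter (· ∈ T)).length * t := by ring
        rw [this]
        exact Nat.add_le_add h1 h2
      · -- a ∉ S, a ∉ T
        have hst : a ∉ symmDiff S T := by simp [Finset.mem_symmDiff, haS, haT]
        rw [lprod_cons_of_not_mem U haS, lprod_cons_of_not_mem U haT, lprod_cons_of_not_mem U hst,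
          List.filter_cons_of_neg (by simpa using haT)]
        exact IH

/-- **The sorting lemma (registered stub `stub_sortingLemma` of line `rank-dehn-ladder`, negative rung N0a).**
Exact involutions `U_i` with `rank [U_i, U_j] ≤ t` give, through the sorted products
`ρ(S) = ∏_{i ∈ S, increasing} U_i`, a uniform almost-homomorphism of `Z_2^n`:
`rank (ρ(S) ρ(T) − ρ(S △ T)) ≤ |S| · |T| · t`. [folklore] -/
theorem stub_sortingLemma :
    ∀ (K : Type) [Field K] (n d t : ℕ) (U : Fin n → Matrix (Fin d) (Fin d) K),
      (∀ i, U i * U i = 1) → (∀ i j, (U i * U j - U j * U i).rank ≤ t) →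
      ∀ S T : Finset (Fin n),
        ((((List.finRange n).filter (· ∈ S)).map U).prod * (((List.finRange n).filter (· ∈ T)).map U).prod -
            (((List.finRange n).filter (· ∈ symmDiff S T)).map U).prod).rank ≤ S.card * T.card * t := by
  intro K _ n d t U hU ht S T
  have h := rank_lprod_mul_sub_le U hU ht S T (List.finRange n) (List.nodup_finRange n)
  refine h.trans ?_
  have hlen := length_filter_mem_le_card (List.nodup_finRange n) T
  exact Nat.mul_le_mul_right t (Nat.mul_le_mul_left _ hlen)

end Summit.PneNP.PneNP.Theorems.CnfIdealGenLengthRankDefectRepresentationsSortingLemma
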